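import Mathlib
import Summits.NavierStokesRegularity.NavierStokesRegularity.Theorems.ThreadingFluxHorizonTowerQuadraticGeneratorSpectral
import Summits.NavierStokesRegularity.NavierStokesRegularity.Theorems.ThreadingFluxHorizonTowerQuadraticGeneratorChart
import Summits.NavierStokesRegularity.NavierStokesRegularity.Theorems.ThreadingFluxHorizonTowerQuadraticGeneratorBrackets
import HarnessLib

/-!
# Crux `PoloidalLiouville` (stmt-NavierStokesRegularity-1222), crux idea «horizon-threading-tower» (ns-idea-15):
# THE QUADRATIC GENERATOR ON THE COMPLEX NULL CONE — the charts of `L`, `M = |Qx|²`, `W = det(x,Qx,Q²x)` are COPRIME off the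
# uniaxial locus

Support file (`--supports stmt-NavierStokesRegularity-1222`, helper; cell `ns-wall-extremal`, width hand ns-wall-eng-3 g5; 0 kit).

The tool the THIRD cone digit needs when a COMPETITOR shell is free (the all-even towers `{2,4,6,8}`, `{2,4,6,10}`, `{6,8,10}`, …: the
digit reads `chartT L ∣ c₁c₂ · chartT W · chartT M` up to a unit): for a REAL traceless symmetric `Q` with `W = det(x,Qx,Q²x) ≢ 0`
(pairwise distinct eigenvalues) the null-cone chart of the generator `L = xᵀQx` has NO common root with the charts of `M = |Qx|²` and of
`W`.  Proof: a common root is a non-zero complex isotropic vector `ε` (`Σ εᵢ² = 0`) with `L(ε) = 0` and `M(ε) = 0` (for `W`: the Gram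
determinant of `(ε, Qε, Q²ε)` gives `W(ε)² = −M(ε)³` once `ρ(ε) = L(ε) = 0`); in the real orthonormal eigenframe `(b_k)` of `Q`
(`Matrix.IsHermitian.eigenvectorBasis`, F4a) the three numbers `ℓ_k = ⟨b_k, ε⟩_ℂ` satisfy the VANDERMONDE system
`Σ ℓ_k² = Σ λ_k ℓ_k² = Σ λ_k² ℓ_k² = 0`, so `ℓ = 0` and `ε = 0` when the `λ_k` are distinct; and a repeated eigenvalue makes
`Q² = βQ + γI`, `M = βL + γρ`, `4W = {L, M} = 0`.

THIS FILE (part 2 of 2; part 1 = `…QuadraticGeneratorSpectral`: spectral sums, Vandermonde, `eq_zero_of_cone_zero`):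
* `eval_map_genW`, `det_sq_of_cone`, `eval_genW_sq_of_cone` — `W(ε) = det(ε,Qε,Q²ε)` and the Gram identity `W(ε)² = −M(ε)³`
  on `{ρ = L = 0}`;
* `degree_chartT_genL_pos` — the chart of a real `L ≠ 0` is not constant;
* ★★ `eq_zero_of_chartT_genL_dvd` — `W ≢ 0`, `chartT L ∣ c · chartT W · chartT M` ⇒ `c = 0`.

HONEST LABEL: polynomial algebra about the typed objects of one crux idea (tool for the order-one finite-tower programme; no tower theorem in
this file); `PoloidalLiouville` (1222) OPEN; W1 movement 0; NS regularity NOT proved.  [folklore]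
-/

-- the summit and its single sub-problem share the name (CONVENTIONS §1)
set_option linter.dupNamespace false

noncomputable section

open MvPolynomial Complex
open scoped Polynomial RealInnerProductSpace
open Literature.Geometry.DiscreteGeometry (inner_fin3 norm_sq_fin3)

namespace Summit.NavierStokesRegularity.NavierStokesRegularity.Theorems.PoloidalLiouville.HorizonTower

namespace Zonal

variable (a b d e f : ℝ)

/-! ### `W(ε) = det(ε, Qε, Q²ε)` and the Gram determinant on `{ρ = L = 0}` -/

/-- `W(ε) = det(ε, Qε, Q²ε)` in coordinates (`q = Qε`, `s = Qq`). [folklore] -/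
theorem eval_map_genW (ε : Fin 3 → ℂ) :
    eval ε (map (algebraMap ℝ ℂ) (genW a b d e f))
      = ε 0 * (((d : ℂ) * ε 0 + b * ε 1 + f * ε 2)
            * ((e : ℂ) * ((a : ℂ) * ε 0 + d * ε 1 + e * ε 2) + f * ((d : ℂ) * ε 0 + b * ε 1 + f * ε 2)
              - (a + b) * ((e : ℂ) * ε 0 + f * ε 1 - (a + b) * ε 2))
          - ((e : ℂ) * ε 0 + f * ε 1 - (a + b) * ε 2)
            * ((d : ℂ) * ((a : ℂ) * ε 0 + d * ε 1 + e * ε 2) + b * ((d : ℂ) * ε 0 + b * ε 1 + f * ε 2)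
              + f * ((e : ℂ) * ε 0 + f * ε 1 - (a + b) * ε 2)))
        + ε 1 * (((e : ℂ) * ε 0 + f * ε 1 - (a + b) * ε 2)
            * ((a : ℂ) * ((a : ℂ) * ε 0 + d * ε 1 + e * ε 2) + d * ((d : ℂ) * ε 0 + b * ε 1 + f * ε 2)
              + e * ((e : ℂ) * ε 0 + f * ε 1 - (a + b) * ε 2))
          - ((a : ℂ) * ε 0 + d * ε 1 + e * ε 2)
            * ((e : ℂ) * ((a : ℂ) * ε 0 + d * ε 1 + e * ε 2) + f * ((d : ℂ) * ε 0 + b * ε 1 + f * ε 2)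
              - (a + b) * ((e : ℂ) * ε 0 + f * ε 1 - (a + b) * ε 2)))
        + ε 2 * (((a : ℂ) * ε 0 + d * ε 1 + e * ε 2)
            * ((d : ℂ) * ((a : ℂ) * ε 0 + d * ε 1 + e * ε 2) + b * ((d : ℂ) * ε 0 + b * ε 1 + f * ε 2)
              + f * ((e : ℂ) * ε 0 + f * ε 1 - (a + b) * ε 2))
          - ((d : ℂ) * ε 0 + b * ε 1 + f * ε 2)
            * ((a : ℂ) * ((a : ℂ) * ε 0 + d * ε 1 + e * ε 2) + d * ((d : ℂ) * ε 0 + b * ε 1 + f * ε 2)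
              + e * ((e : ℂ) * ε 0 + f * ε 1 - (a + b) * ε 2))) := by
  simp [genW, genQ0, genQ1, genQ2, genS0, genS1, genS2]

/-- The Gram (Cauchy–Binet) identity for three vectors on the null cone: `Σεᵢ² = 0`, `ε·q = 0`, `ε·s = q·q` ⇒
`det(ε, q, s)² = −(q·q)³`. [folklore] -/
theorem det_sq_of_cone (e0 e1 e2 q0 q1 q2 s0 s1 s2 : ℂ) (hρ : e0 ^ 2 + e1 ^ 2 + e2 ^ 2 = 0)
    (hL : e0 * q0 + e1 * q1 + e2 * q2 = 0) (hS : e0 * s0 + e1 * s1 + e2 * s2 = q0 ^ 2 + q1 ^ 2 + q2 ^ 2) :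
    (e0 * (q1 * s2 - q2 * s1) + e1 * (q2 * s0 - q0 * s2) + e2 * (q0 * s1 - q1 * s0)) ^ 2
      = -((q0 ^ 2 + q1 ^ 2 + q2 ^ 2) ^ 3) := by
  linear_combination ((q0 ^ 2 + q1 ^ 2 + q2 ^ 2) * (s0 ^ 2 + s1 ^ 2 + s2 ^ 2) - (q0 * s0 + q1 * s1 + q2 * s2) ^ 2) * hρ
    + (-((e0 * q0 + e1 * q1 + e2 * q2) * (s0 ^ 2 + s1 ^ 2 + s2 ^ 2))
        + 2 * (q0 * s0 + q1 * s1 + q2 * s2) * (e0 * s0 + e1 * s1 + e2 * s2)) * hL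
    + (-(q0 ^ 2 + q1 ^ 2 + q2 ^ 2) * ((e0 * s0 + e1 * s1 + e2 * s2) + (q0 ^ 2 + q1 ^ 2 + q2 ^ 2))) * hS

/-- On the complex null cone and on `{L = 0}`: `W(ε)² = −M(ε)³`. [folklore] -/
theorem eval_genW_sq_of_cone {ε : Fin 3 → ℂ} (hρ : eval ε (map (algebraMap ℝ ℂ) (normSq : RPoly)) = 0)
    (hL : eval ε (map (algebraMap ℝ ℂ) (genL a b d e f)) = 0) :
    eval ε (map (algebraMap ℝ ℂ) (genW a b d e f)) ^ 2 = -(eval ε (map (algebraMap ℝ ℂ) (genM a b d e f)) ^ 3) := by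
  rw [eval_map_normSq] at hρ
  rw [eval_map_genL] at hL
  rw [eval_map_genW, eval_map_genM]
  exact det_sq_of_cone (ε 0) (ε 1) (ε 2) _ _ _ _ _ _ hρ (by linear_combination hL) (by ring)

/-! ### ★★ The charts of `L`, `M`, `W` are coprime off the uniaxial locus -/

/-- For a REAL generator the null-cone chart of `L ≠ 0` is not a constant. [folklore] -/
theorem degree_chartT_genL_pos (hL : genL a b d e f ≠ 0) :
    0 < (chartT (map (algebraMap ℝ ℂ) (genL a b d e f))).degree := by
  by_contra hdeg
  have hp0 : chartT (map (algebraMap ℝ ℂ) (genL a b d e f)) ≠ 0 := fun h0 =>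
    hL (eq_zero_of_chartT_map_eq_zero (isHomogeneous_genL a b d e f) (lapP_genL a b d e f) h0)
  have hc := Polynomial.eq_C_of_degree_le_zero (not_lt.mp hdeg)
  rw [map_genL] at hc
  have hq := chartT_genL ((algebraMap ℝ ℂ) a) ((algebraMap ℝ ℂ) b) ((algebraMap ℝ ℂ) d) ((algebraMap ℝ ℂ) e)
    ((algebraMap ℝ ℂ) f)
  simp only [Complex.coe_algebraMap] at hq hc
  have h1 := congrArg (Polynomial.coeff · 1) hc
  have h2 := congrArg (Polynomial.coeff · 2) hc
  have h4 := congrArg (Polynomial.coeff · 4) hc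
  simp only [hq, Polynomial.coeff_add, Polynomial.coeff_C_mul, Polynomial.coeff_X_pow, Polynomial.coeff_C,
    Polynomial.coeff_X] at h1 h2 h4
  norm_num at h1 h2 h4
  -- `e + i f = 0`, `a + b = 0`, `a - b - 2 i d = 0` with real `a b d e f`
  have he : e = 0 := by have := congrArg Complex.re h1; simpa using this
  have hf : f = 0 := by have := congrArg Complex.im h1; simpa using this
  have hab : a + b = 0 := by have := congrArg Complex.re h2; simpa using this
  have hab' : a - b = 0 := by have := congrArg Complex.re h4; simpa using this
  have hd : d = 0 := by have := congrArg Complex.im h4; simpa using this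
  have ha : a = 0 := by linarith
  have hb : b = 0 := by linarith
  apply hL
  subst ha; subst hb; subst hd; subst he; subst hf
  simp [genL, genQ0, genQ1, genQ2]

/-- ★★ **THE GENERATOR CHARTS ARE COPRIME OFF THE UNIAXIAL LOCUS.**  For a real traceless symmetric `Q` with
`W = det(x,Qx,Q²x) ≢ 0`: if `chartT L` divides `c · chartT W · chartT M` then `c = 0` (a root of `chartT L` is a non-zero isotropic
common zero of `L` and `W·M`, and `W(ε)² = −M(ε)³` there). This is what the third cone digit of the all-even towers with a free competitor
shell (`{2,4,6,8}`, …) needs. [folklore] -/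
theorem eq_zero_of_chartT_genL_dvd (hW : genW a b d e f ≠ 0) {c : ℂ}
    (hdiv : chartT (map (algebraMap ℝ ℂ) (genL a b d e f))
      ∣ Polynomial.C c * (chartT (map (algebraMap ℝ ℂ) (genW a b d e f)) * chartT (map (algebraMap ℝ ℂ) (genM a b d e f)))) :
    c = 0 := by
  have hL : genL a b d e f ≠ 0 := by
    intro h0
    obtain ⟨ha, hb, hd, he, hf⟩ := gen_eq_zero_of_genL_eq_zero (a := (a : ℂ)) (b := b) (d := d) (e := e) (f := f)
      (by rw [← Complex.coe_algebraMap, ← map_genL, h0, map_zero])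
    apply hW
    rw [Complex.ofReal_eq_zero] at ha hb hd he hf
    subst ha; subst hb; subst hd; subst he; subst hf
    simp [genW, genQ0, genQ1, genQ2, genS0, genS1, genS2]
  obtain ⟨t₀, ht₀⟩ := Complex.exists_root (degree_chartT_genL_pos a b d e f hL)
  set ε : Fin 3 → ℂ := isoVec 1 t₀ with hε
  have hε0 : ε ≠ 0 := isoVec_one_ne_zero t₀
  have hLε : eval ε (map (algebraMap ℝ ℂ) (genL a b d e f)) = 0 := by rw [hε, ← eval_chartT]; exact ht₀
  have hρε : eval ε (map (algebraMap ℝ ℂ) (normSq : RPoly)) = 0 := by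
    rw [eval_map_normSq, hε]; exact isoVec_sq_sum 1 t₀
  have hprod := Polynomial.eval_eq_zero_of_dvd_of_eval_eq_zero hdiv ht₀
  rw [Polynomial.eval_mul, Polynomial.eval_mul, Polynomial.eval_C, eval_chartT, eval_chartT, ← hε] at hprod
  rcases mul_eq_zero.mp hprod with hc | hWM
  · exact hc
  · exfalso
    have hMε : eval ε (map (algebraMap ℝ ℂ) (genM a b d e f)) = 0 := by
      rcases mul_eq_zero.mp hWM with hWε | hMε
      · have h := eval_genW_sq_of_cone a b d e f hρε hLε
        rw [hWε, zero_pow two_ne_zero, eq_comm, neg_eq_zero] at h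
        exact (pow_eq_zero_iff three_ne_zero).mp h
      · exact hMε
    exact hε0 (eq_zero_of_cone_zero a b d e f hW hρε hLε hMε)

end Zonal

end Summit.NavierStokesRegularity.NavierStokesRegularity.Theorems.PoloidalLiouville.HorizonTower

end
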